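import Summits.ResolutionOfSingularities.ResolutionOfSingularities.Theorems.FrobeniusLadderFInjectiveMacaulayficationFCentreE1ChartWitness
import Summits.ResolutionOfSingularities.ResolutionOfSingularities.Theorems.FrobeniusLadderFInjectiveMacaulayficationMonomialChartPresentationKernel
import Summits.ResolutionOfSingularities.ResolutionOfSingularities.Theorems.FrobeniusLadderFInjectiveMacaulayficationQ6CNKit
import Summits.ResolutionOfSingularities.ResolutionOfSingularities.Theorems.FrobeniusClosingPatchingRelPerfectCoreRungClosure
import Literature.AlgebraicGeometry.Resolution.BlowupsScaling
import Literature.AlgebraicGeometry.Resolution.AffineBlowupUniversal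
import Mathlib.LinearAlgebra.Matrix.NonsingularInverse
import HarnessLib

/-!
# R17.11 TIER-1, PLUMBING PART 2 — LEMMA E IN THE KERNEL: the `x⁸`-chart of `Bl_{x⁶𝔮} = Bl_𝔮 = Bl_{𝔮⁴}` of the P2d4C specimen is `k[x, T_y, T_u, T_t, T_z]/(F′)`
# (crux `FInjectiveMacaulayfication` stmt-ResolutionOfSingularities-15315, chain w45a; res-L1-w45a-plan-1 R17.11 (2) / R17.13 (3); res-L1-w45a-tri-2 03:18:48Z LEMMA E, #380
# «Bl_{𝔮⁴} ≅ Bl_𝔮 may shorten it»; seat res-L1-w45a-stub-1 g9)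

[OURS · L1 W4.5a] Support file (`--supports stmt-ResolutionOfSingularities-15315 --as helper`); replaces the role of NO printed item; NOT a
statement of the manuscript; def-free, unconditional. AI-written (AI review is weaker than expert review).

## What is here (`R̄ = k[x,y,u,t,z]/(f)`, `f = z² + x⁴z + y³ + u³ + t³`; `X 0 = x`, `X 1..3 = y,u,t`, `X 4 = z`; `𝔮̄ = (x̄², ȳ, ū, t̄, z̄)`)
* §1 `exists_chartPresentation` — **LEMMA E**: a BIJECTIVE ring homomorphism `k[x,T]/(F′) → R̄[I_A/x̄⁸] = blowupAlgebra I_A x̄⁸` onto the affine blow-up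
  algebra of the MONOMIAL ideal `I_A = (x̄⁸, x̄⁹, x̄⁶ȳ, x̄⁶ū, x̄⁶t̄, x̄⁶z̄)` in the chart `x⁸`, sending `T̄_j ↦ x̄⁶X̄_j / x̄⁸` and `θ q ↦ q̄/1` — an instance of
  res-L1-w45a-stub-1's (C1) `MonomialChartPresentationKernel.exists_monomialChartPresentation` with the unimodular matrix `V` = identity with first row
  `(1,2,2,2,2)` (the substitution `x ↦ x`, `X_j ↦ x²X_j`), chart exponent `m = 8e₀`, neighbours `a₀ = 9e₀`, `a_j = 6e₀ + e_j`, `d = 4e₀`,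
  `θ f = x⁴ F′` (`FCentreE1ChartWitness.theta_chart`), no variable dividing `F′`; data checks by `decide` through `Q6CNKit`.
* §2 `span_A_eq` — `I_A = (x̄⁶) · 𝔮̄` as ideals of `R̄`; hence ★ `affineBlowup_IA_isBlowup_q` / `affineBlowup_IA_isBlowup_q_pow` — **the model `affineBlowup I_A` is a
  blowing up of `Spec R̄` along `𝔮̄` AND along `𝔮̄⁴`** (`isBlowup_span_singleton_mul_iff`: the principal factor `x̄⁶` does not change the blow-up;
  `isBlowup_idealSheaf_pow`: neither does the power). So the F-blowup of LEMMA N (a blowing up along `c·𝔮̄⁴`) is, up to the unique isomorphism of blowings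
  up, `affineBlowup I_A`, whose `x⁸`-chart §1 identifies with `Spec k[x,T]/(F′)` — where `FCentreE1ChartWitness.not_fullCl_chartOrigin` (p604021) exhibits a
  NON-FULL point. (Remaining for the ✗: base change to `Spec 𝒪_{X,v}` and the F-blowup uniqueness over `U = ⊤`; see `FCentreE1-PLUMBING-PLAN.md`.)

[folklore mathematics, OURS as a certificate; cite: CoxLittleSchenck2011, §2.3/§10 (toric charts of monomial blow-ups); StacksProject, Tag 080A]
-/

-- single-problem summit: the doubled namespace component is forced
set_option linter.dupNamespace false

noncomputable section

open AlgebraicGeometry CategoryTheory Literature.AlgebraicGeometry.Resolution MvPolynomial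

namespace Summit.ResolutionOfSingularities.ResolutionOfSingularities.Theorems.FInjectiveMacaulayfication.FCentreE1ChartPresentation

open Summit.ResolutionOfSingularities.ResolutionOfSingularities.Theorems.FInjectiveMacaulayfication
open FCentreE1ChartWitness

/-! ## §1 LEMMA E: the chart presentation (C1 instance) -/

/-- The chart substitution matrix `V` (identity with first row `(1,2,2,2,2)`) is unimodular: `V · W = 1` for the explicit integer inverse. [folklore] -/
theorem hV : IsUnit ((( !![1, 2, 2, 2, 2; 0, 1, 0, 0, 0; 0, 0, 1, 0, 0; 0, 0, 0, 1, 0; 0, 0, 0, 0, 1] : Matrix (Fin 5) (Fin 5) ℕ)).map (Nat.cast : ℕ → ℤ)).det := by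
  refine Matrix.isUnit_det_of_right_inverse (B := !![1, -2, -2, -2, -2; 0, 1, 0, 0, 0; 0, 0, 1, 0, 0; 0, 0, 0, 1, 0; 0, 0, 0, 0, 1]) ?_
  decide

/-- The chart substitution as the monomial map of `V`: `X_j ↦ ∏ᵢ Xᵢ^{V i j}` is `x ↦ x`, `X_j ↦ x²X_j`. [folklore] -/
theorem prod_pow_V (k : Type) [Field k] :
    (fun j : Fin 5 => ∏ i : Fin 5, (X i : MvPolynomial (Fin 5) k) ^
        (( !![1, 2, 2, 2, 2; 0, 1, 0, 0, 0; 0, 0, 1, 0, 0; 0, 0, 0, 1, 0; 0, 0, 0, 0, 1] : Matrix (Fin 5) (Fin 5) ℕ) i j)) =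
      fun j : Fin 5 => if j = 0 then (X 0 : MvPolynomial (Fin 5) k) else X 0 ^ 2 * X j := by
  funext j
  fin_cases j <;> simp [Fin.prod_univ_five]

/-- ★ **LEMMA E (res-L1-w45a-tri-2 03:18:48Z) in the kernel.** For `f = z² + x⁴z + y³ + u³ + t³` and `F′ = T_z² + x²T_z + x²(T_y³ + T_u³ + T_t³)` over any field:
a BIJECTIVE ring homomorphism from `k[x,T]/(F′)` onto the affine blow-up algebra `R̄[I_A/x̄⁸]`, `R̄ = k[X]/(f)`, `I_A = (x̄⁸, x̄⁹, x̄⁶ȳ, x̄⁶ū, x̄⁶t̄, x̄⁶z̄)`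
(`= x̄⁶·𝔮̄`, §2), sending `θ q ↦ q̄/1` for the chart substitution `θ : x ↦ x, X_j ↦ x²X_j`. Instance of (C1) `exists_monomialChartPresentation`.
[folklore; cite: CoxLittleSchenck2011, §2.3] -/
theorem exists_chartPresentation (k : Type) [Field k] [CharP k 2] (f F' : MvPolynomial (Fin 5) k)
    (hf : f = X 4 ^ 2 + X 0 ^ 4 * X 4 + X 1 ^ 3 + X 2 ^ 3 + X 3 ^ 3)
    (hF : F' = X 4 ^ 2 + X 0 ^ 2 * X 4 + X 0 ^ 2 * (X 1 ^ 3 + X 2 ^ 3 + X 3 ^ 3)) :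
    ∃ e : (MvPolynomial (Fin 5) k ⧸ Ideal.span {F'}) →+*
        ↥(blowupAlgebra
          (Ideal.span ((fun e : Fin 5 →₀ ℕ => Ideal.Quotient.mk (Ideal.span {f}) (monomial e (1 : k))) ''
            ((([![8, 0, 0, 0, 0], ![9, 0, 0, 0, 0], ![6, 1, 0, 0, 0], ![6, 0, 1, 0, 0], ![6, 0, 0, 1, 0], ![6, 0, 0, 0, 1]] : List (Fin 5 → ℕ)).map
              fun u => (Finsupp.equivFunOnFinite.symm u : Fin 5 →₀ ℕ)).toFinset : Set _)))
          (Ideal.Quotient.mk (Ideal.span {f}) (monomial (Finsupp.equivFunOnFinite.symm ![8, 0, 0, 0, 0]) (1 : k)))),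
      Function.Bijective e ∧
      (∀ q : MvPolynomial (Fin 5) k, (e (Ideal.Quotient.mk (Ideal.span {F'})
          (aeval (fun j : Fin 5 => if j = 0 then (X 0 : MvPolynomial (Fin 5) k) else X 0 ^ 2 * X j) q))).val =
        algebraMap (MvPolynomial (Fin 5) k ⧸ Ideal.span {f})
          (Localization.Away (Ideal.Quotient.mk (Ideal.span {f}) (monomial (Finsupp.equivFunOnFinite.symm ![8, 0, 0, 0, 0]) (1 : k))))
          (Ideal.Quotient.mk (Ideal.span {f}) q)) := by
  -- the data
  have hgen : ∀ i : Fin 5,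
      (Finsupp.equivFunOnFinite.symm ((( !![1, 2, 2, 2, 2; 0, 1, 0, 0, 0; 0, 0, 1, 0, 0; 0, 0, 0, 1, 0; 0, 0, 0, 0, 1] :
        Matrix (Fin 5) (Fin 5) ℕ)).mulVec ⇑((fun i : Fin 5 => (Finsupp.equivFunOnFinite.symm
          ((![![9, 0, 0, 0, 0], ![6, 1, 0, 0, 0], ![6, 0, 1, 0, 0], ![6, 0, 0, 1, 0], ![6, 0, 0, 0, 1]] : Fin 5 → Fin 5 → ℕ) i) : Fin 5 →₀ ℕ)) i)) :
          Fin 5 →₀ ℕ) =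
        Finsupp.equivFunOnFinite.symm ((( !![1, 2, 2, 2, 2; 0, 1, 0, 0, 0; 0, 0, 1, 0, 0; 0, 0, 0, 1, 0; 0, 0, 0, 0, 1] :
          Matrix (Fin 5) (Fin 5) ℕ)).mulVec ⇑(Finsupp.equivFunOnFinite.symm (![8, 0, 0, 0, 0] : Fin 5 → ℕ) : Fin 5 →₀ ℕ)) +
          Finsupp.single i 1 := by
    intro i
    fin_cases i <;> exact Q6CNKit.hgen_of_vec _ _ _ _ (by decide)
  have haA : ∀ i : Fin 5, (fun i : Fin 5 => (Finsupp.equivFunOnFinite.symm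
      ((![![9, 0, 0, 0, 0], ![6, 1, 0, 0, 0], ![6, 0, 1, 0, 0], ![6, 0, 0, 1, 0], ![6, 0, 0, 0, 1]] : Fin 5 → Fin 5 → ℕ) i) : Fin 5 →₀ ℕ)) i ∈
      (([![8, 0, 0, 0, 0], ![9, 0, 0, 0, 0], ![6, 1, 0, 0, 0], ![6, 0, 1, 0, 0], ![6, 0, 0, 1, 0], ![6, 0, 0, 0, 1]] : List (Fin 5 → ℕ)).map
        fun u => (Finsupp.equivFunOnFinite.symm u : Fin 5 →₀ ℕ)).toFinset := by
    intro i
    fin_cases i <;> exact (Q6CNKit.mem_image_symm _ _).mpr (by decide)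
  have hge := Q6CNKit.hge_of_vec (( !![1, 2, 2, 2, 2; 0, 1, 0, 0, 0; 0, 0, 1, 0, 0; 0, 0, 0, 1, 0; 0, 0, 0, 0, 1] : Matrix (Fin 5) (Fin 5) ℕ))
    ([![8, 0, 0, 0, 0], ![9, 0, 0, 0, 0], ![6, 1, 0, 0, 0], ![6, 0, 1, 0, 0], ![6, 0, 0, 1, 0], ![6, 0, 0, 0, 1]] : List (Fin 5 → ℕ))
    (![8, 0, 0, 0, 0] : Fin 5 → ℕ) (by decide)
  -- `θ f = x⁴ · F′` in the monomial-map form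
  have hg : aeval (fun j : Fin 5 => ∏ i : Fin 5, (X i : MvPolynomial (Fin 5) k) ^
        (( !![1, 2, 2, 2, 2; 0, 1, 0, 0, 0; 0, 0, 1, 0, 0; 0, 0, 0, 1, 0; 0, 0, 0, 0, 1] : Matrix (Fin 5) (Fin 5) ℕ) i j)) f =
      monomial (Finsupp.equivFunOnFinite.symm (![4, 0, 0, 0, 0] : Fin 5 → ℕ)) (1 : k) * F' := by
    rw [prod_pow_V, theta_chart k f F' hf hF]
    congr 1
    have : (Finsupp.equivFunOnFinite.symm (![4, 0, 0, 0, 0] : Fin 5 → ℕ) : Fin 5 →₀ ℕ) = Finsupp.single 0 4 := by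
      ext i
      rw [Finsupp.coe_equivFunOnFinite_symm, Finsupp.single_apply]
      fin_cases i <;> simp
    rw [this, X_pow_eq_monomial]
  -- `(hunit)`: `5 • m = Σ dᵢ • aᵢ + 4e₀`
  have hunit : ∃ (N : ℕ) (r : Fin 5 →₀ ℕ), N • (Finsupp.equivFunOnFinite.symm (![8, 0, 0, 0, 0] : Fin 5 → ℕ) : Fin 5 →₀ ℕ) =
      ∑ i : Fin 5, (Finsupp.equivFunOnFinite.symm (![4, 0, 0, 0, 0] : Fin 5 → ℕ) : Fin 5 →₀ ℕ) i •
        (fun i : Fin 5 => (Finsupp.equivFunOnFinite.symm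
          ((![![9, 0, 0, 0, 0], ![6, 1, 0, 0, 0], ![6, 0, 1, 0, 0], ![6, 0, 0, 1, 0], ![6, 0, 0, 0, 1]] : Fin 5 → Fin 5 → ℕ) i) : Fin 5 →₀ ℕ)) i + r := by
    refine ⟨5, Finsupp.equivFunOnFinite.symm (![4, 0, 0, 0, 0] : Fin 5 → ℕ), ?_⟩
    ext l
    simp only [Finsupp.coe_smul, Finsupp.coe_add, Pi.smul_apply, Pi.add_apply,
      Finsupp.coe_equivFunOnFinite_symm, smul_eq_mul, Fin.sum_univ_five]
    fin_cases l <;> rfl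
  -- no variable divides `F′`
  have hcop : ∀ i : Fin 5, ¬ (X i ∣ F') := by
    intro i
    by_cases hi : i = 4
    · subst hi
      refine WildPinchClosedCentre.not_X_dvd_of_eval (![1, 1, 0, 0, 0] : Fin 5 → k) 4 (by simp) F' ?_
      rw [hF]
      simp
    · refine WildPinchClosedCentre.not_X_dvd_of_eval (Pi.single 4 1) i (Pi.single_eq_of_ne hi _) F' ?_
      rw [hF]
      simp
  obtain ⟨e, hbij, -, heθ⟩ := MonomialChartPresentationKernel.exists_monomialChartPresentation f _ hV _ _ hgen _ haA hge _ F' hg hunit hcop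
  refine ⟨e, hbij, fun q => ?_⟩
  rw [← prod_pow_V]
  exact heθ q

/-! ## §2 `I_A = x̄⁶ · 𝔮̄`; the model `affineBlowup I_A` is a blowing up along `𝔮̄` and along `𝔮̄⁴` -/

/-- The six generators of `I_A`, written out in `R̄`. [plumbing] -/
theorem mk_monomial_symm (k : Type) [Field k] (f : MvPolynomial (Fin 5) k) (u : Fin 5 → ℕ) :
    Ideal.Quotient.mk (Ideal.span {f}) (monomial (Finsupp.equivFunOnFinite.symm u) (1 : k)) =
      Ideal.Quotient.mk (Ideal.span {f}) (X 0) ^ u 0 * Ideal.Quotient.mk (Ideal.span {f}) (X 1) ^ u 1 *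
        Ideal.Quotient.mk (Ideal.span {f}) (X 2) ^ u 2 * Ideal.Quotient.mk (Ideal.span {f}) (X 3) ^ u 3 *
        Ideal.Quotient.mk (Ideal.span {f}) (X 4) ^ u 4 := by
  rw [monomial_eq, C_1, one_mul, Finsupp.prod_fintype _ _ (fun i => by simp), Fin.prod_univ_five]
  simp only [Finsupp.coe_equivFunOnFinite_symm, map_mul, map_pow]

/-- **`I_A = (x̄⁶) · (x̄², ȳ, ū, t̄, z̄)`** as ideals of `R̄ = k[X]/(f)` (`x̄⁹ = x̄ · x̄⁸` is redundant). [folklore] -/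
theorem span_A_eq (k : Type) [Field k] (f : MvPolynomial (Fin 5) k) :
    Ideal.span ((fun e : Fin 5 →₀ ℕ => Ideal.Quotient.mk (Ideal.span {f}) (monomial e (1 : k))) ''
        ((([![8, 0, 0, 0, 0], ![9, 0, 0, 0, 0], ![6, 1, 0, 0, 0], ![6, 0, 1, 0, 0], ![6, 0, 0, 1, 0], ![6, 0, 0, 0, 1]] : List (Fin 5 → ℕ)).map
          fun u => (Finsupp.equivFunOnFinite.symm u : Fin 5 →₀ ℕ)).toFinset : Set _)) =
      Ideal.span {Ideal.Quotient.mk (Ideal.span {f}) (X 0) ^ 6} *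
        Ideal.span {Ideal.Quotient.mk (Ideal.span {f}) (X 0) ^ 2, Ideal.Quotient.mk (Ideal.span {f}) (X 1),
          Ideal.Quotient.mk (Ideal.span {f}) (X 2), Ideal.Quotient.mk (Ideal.span {f}) (X 3), Ideal.Quotient.mk (Ideal.span {f}) (X 4)} := by
  set mk := Ideal.Quotient.mk (Ideal.span {f}) with hmk
  set Q5 : Ideal (MvPolynomial (Fin 5) k ⧸ Ideal.span {f}) := Ideal.span {mk (X 0) ^ 2, mk (X 1), mk (X 2), mk (X 3), mk (X 4)} with hQ5
  have hx2 : mk (X 0) ^ 2 ∈ Q5 := Ideal.subset_span (by simp)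
  have h1 : mk (X 1) ∈ Q5 := Ideal.subset_span (by simp)
  have h2 : mk (X 2) ∈ Q5 := Ideal.subset_span (by simp)
  have h3 : mk (X 3) ∈ Q5 := Ideal.subset_span (by simp)
  have h4 : mk (X 4) ∈ Q5 := Ideal.subset_span (by simp)
  have hx6 : mk (X 0) ^ 6 ∈ Ideal.span {mk (X 0) ^ 6} := Ideal.mem_span_singleton_self _
  -- membership of the six generators in the product
  have hgen8 : mk (X 0) ^ 8 ∈ Ideal.span {mk (X 0) ^ 6} * Q5 := by
    rw [show mk (X 0) ^ 8 = mk (X 0) ^ 6 * mk (X 0) ^ 2 by ring]; exact Ideal.mul_mem_mul hx6 hx2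
  have hgen9 : mk (X 0) ^ 9 ∈ Ideal.span {mk (X 0) ^ 6} * Q5 := by
    rw [show mk (X 0) ^ 9 = mk (X 0) * (mk (X 0) ^ 6 * mk (X 0) ^ 2) by ring]
    exact Ideal.mul_mem_left _ _ (Ideal.mul_mem_mul hx6 hx2)
  apply le_antisymm
  · rw [Ideal.span_le]
    rintro _ ⟨e, he, rfl⟩
    obtain ⟨u, hu, rfl⟩ := Q6CNKit.exists_of_mem_image_symm _ e he
    change mk (monomial (Finsupp.equivFunOnFinite.symm u) (1 : k)) ∈ _
    rw [hmk, mk_monomial_symm, ← hmk]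
    simp only [List.mem_cons, List.not_mem_nil, or_false] at hu
    rcases hu with rfl | rfl | rfl | rfl | rfl | rfl <;>
      simp only [Matrix.cons_val_zero, Matrix.cons_val_one, Matrix.cons_val, pow_zero, pow_one, mul_one]
    · exact hgen8
    · exact hgen9
    · exact Ideal.mul_mem_mul hx6 h1
    · exact Ideal.mul_mem_mul hx6 h2
    · exact Ideal.mul_mem_mul hx6 h3
    · exact Ideal.mul_mem_mul hx6 h4
  · -- `(x̄⁶)·𝔮̄ ⊆ I_A`: the five products are generators of `I_A`
    have hmemA : ∀ u : Fin 5 → ℕ, u ∈ ([![8, 0, 0, 0, 0], ![9, 0, 0, 0, 0], ![6, 1, 0, 0, 0], ![6, 0, 1, 0, 0], ![6, 0, 0, 1, 0],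
        ![6, 0, 0, 0, 1]] : List (Fin 5 → ℕ)) →
        mk (X 0) ^ u 0 * mk (X 1) ^ u 1 * mk (X 2) ^ u 2 * mk (X 3) ^ u 3 * mk (X 4) ^ u 4 ∈
          Ideal.span ((fun e : Fin 5 →₀ ℕ => mk (monomial e (1 : k))) ''
            ((([![8, 0, 0, 0, 0], ![9, 0, 0, 0, 0], ![6, 1, 0, 0, 0], ![6, 0, 1, 0, 0], ![6, 0, 0, 1, 0], ![6, 0, 0, 0, 1]] :
              List (Fin 5 → ℕ)).map fun u => (Finsupp.equivFunOnFinite.symm u : Fin 5 →₀ ℕ)).toFinset : Set _)) := by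
      intro u hu
      rw [← mk_monomial_symm]
      exact Ideal.subset_span ⟨_, Finset.mem_coe.mpr ((Q6CNKit.mem_image_symm _ _).mpr hu), rfl⟩
    rw [hQ5, Ideal.span_mul_span, Ideal.span_le]
    rintro _ ⟨a, ha, b, hb, rfl⟩
    rw [Set.mem_singleton_iff] at ha
    subst ha
    simp only [Set.mem_insert_iff, Set.mem_singleton_iff] at hb
    change mk (X 0) ^ 6 * b ∈ Ideal.span _
    rcases hb with rfl | rfl | rfl | rfl | rfl
    · have h := hmemA ![8, 0, 0, 0, 0] (by simp)
      simp only [Matrix.cons_val_zero, Matrix.cons_val_one, Matrix.cons_val, pow_zero, mul_one] at h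
      rw [show mk (X 0) ^ 6 * mk (X 0) ^ 2 = mk (X 0) ^ 8 by ring]; exact h
    · have h := hmemA ![6, 1, 0, 0, 0] (by simp)
      simpa only [Matrix.cons_val_zero, Matrix.cons_val_one, Matrix.cons_val, pow_zero, pow_one, mul_one] using h
    · have h := hmemA ![6, 0, 1, 0, 0] (by simp)
      simpa only [Matrix.cons_val_zero, Matrix.cons_val_one, Matrix.cons_val, pow_zero, pow_one, mul_one] using h
    · have h := hmemA ![6, 0, 0, 1, 0] (by simp)
      simpa only [Matrix.cons_val_zero, Matrix.cons_val_one, Matrix.cons_val, pow_zero, pow_one, mul_one] using h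
    · have h := hmemA ![6, 0, 0, 0, 1] (by simp)
      simpa only [Matrix.cons_val_zero, Matrix.cons_val_one, Matrix.cons_val, pow_zero, pow_one, mul_one] using h

/-- A variable `X_j` is non-zero in `R̄ = k[X]/(f)` as soon as `f` is prime and does not vanish at a point with `j`-th coordinate `0`. [plumbing] -/
theorem mk_X_ne_zero_of_eval (k : Type) [Field k] (f : MvPolynomial (Fin 5) k) (hfprime : (Ideal.span {f}).IsPrime)
    (j : Fin 5) (P : Fin 5 → k) (hPj : P j = 0) (hfP : MvPolynomial.eval P f ≠ 0) :
    Ideal.Quotient.mk (Ideal.span {f}) (X j) ≠ 0 := fun h0 =>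
  PrimeTransfer.X_not_mem_span_of_isPrime hfprime
    (fun hf => WildPinchClosedCentre.not_X_dvd_of_eval P j hPj f hfP (Ideal.mem_span_singleton.mp hf))
    (Ideal.Quotient.eq_zero_iff_mem.mp h0)

/-- `x̄ ≠ 0` and `ȳ ≠ 0` in `R̄` (`f(0,1,0,0,0) = f(1,0,0,0,0)… ≠ 0`; here `f(e_y) = 1`, `f(e_x) = 0`… we use the points `e_y` and `e_x + …`). [plumbing] -/
theorem mk_X_ne_zero (k : Type) [Field k] [CharP k 2] (f : MvPolynomial (Fin 5) k)
    (hf : f = X 4 ^ 2 + X 0 ^ 4 * X 4 + X 1 ^ 3 + X 2 ^ 3 + X 3 ^ 3) :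
    Ideal.Quotient.mk (Ideal.span {f}) (X 0) ≠ 0 ∧ Ideal.Quotient.mk (Ideal.span {f}) (X 1) ≠ 0 := by
  have hfprime : (Ideal.span {f}).IsPrime := (Ideal.span_singleton_prime (prime_f k f hf).ne_zero).mpr (prime_f k f hf)
  refine ⟨mk_X_ne_zero_of_eval k f hfprime 0 (Pi.single 1 1) (by simp) ?_,
    mk_X_ne_zero_of_eval k f hfprime 1 (Pi.single 2 1) (by simp) ?_⟩
  · rw [hf]
    simp
  · rw [hf]
    simp

/-- ★ **The model `affineBlowup I_A` is a blowing up of `Spec R̄` along `𝔮̄ = (x̄², ȳ, ū, t̄, z̄)`** (the principal factor `x̄⁶` does not change the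
blow-up: `IsBlowup.of_span_singleton_mul`). [cite: Villamayoru2006, proof of Thm. 3.3] -/
theorem affineBlowup_IA_isBlowup_q (k : Type) [Field k] [CharP k 2] (f : MvPolynomial (Fin 5) k)
    (hf : f = X 4 ^ 2 + X 0 ^ 4 * X 4 + X 1 ^ 3 + X 2 ^ 3 + X 3 ^ 3) :
    IsBlowup (affineBlowup.π (Ideal.span ((fun e : Fin 5 →₀ ℕ => Ideal.Quotient.mk (Ideal.span {f}) (monomial e (1 : k))) ''
        ((([![8, 0, 0, 0, 0], ![9, 0, 0, 0, 0], ![6, 1, 0, 0, 0], ![6, 0, 1, 0, 0], ![6, 0, 0, 1, 0], ![6, 0, 0, 0, 1]] : List (Fin 5 → ℕ)).map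
          fun u => (Finsupp.equivFunOnFinite.symm u : Fin 5 →₀ ℕ)).toFinset : Set _))))
      (affineBlowup.idealSheaf (Ideal.span {Ideal.Quotient.mk (Ideal.span {f}) (X 0) ^ 2, Ideal.Quotient.mk (Ideal.span {f}) (X 1),
          Ideal.Quotient.mk (Ideal.span {f}) (X 2), Ideal.Quotient.mk (Ideal.span {f}) (X 3), Ideal.Quotient.mk (Ideal.span {f}) (X 4)})) := by
  haveI : (Ideal.span {f}).IsPrime := (Ideal.span_singleton_prime (prime_f k f hf).ne_zero).mpr (prime_f k f hf)
  haveI : IsDomain (MvPolynomial (Fin 5) k ⧸ Ideal.span {f}) := Ideal.Quotient.isDomain _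
  have h := affineBlowup.isBlowup (Ideal.span ((fun e : Fin 5 →₀ ℕ => Ideal.Quotient.mk (Ideal.span {f}) (monomial e (1 : k))) ''
        ((([![8, 0, 0, 0, 0], ![9, 0, 0, 0, 0], ![6, 1, 0, 0, 0], ![6, 0, 1, 0, 0], ![6, 0, 0, 1, 0], ![6, 0, 0, 0, 1]] : List (Fin 5 → ℕ)).map
          fun u => (Finsupp.equivFunOnFinite.symm u : Fin 5 →₀ ℕ)).toFinset : Set _)))
  rw [span_A_eq] at h ⊢
  refine IsBlowup.of_span_singleton_mul ?_ (pow_ne_zero 6 (mk_X_ne_zero k f hf).1) h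
  intro hbot
  have : Ideal.Quotient.mk (Ideal.span {f}) (X 1) ∈ (⊥ : Ideal (MvPolynomial (Fin 5) k ⧸ Ideal.span {f})) :=
    hbot ▸ Ideal.subset_span (by simp)
  exact (mk_X_ne_zero k f hf).2 ((Ideal.mem_bot).mp this)

/-- ★ **… and along `𝔮̄⁴`** (a blowing up of `K` is one of `K⁴`, Stacks 080A: `CoreRungClosure.isBlowup_idealSheaf_pow`) — the centre of LEMMA N up to the
principal factor `c`. [cite: StacksProject, Tag 080A] -/
theorem affineBlowup_IA_isBlowup_q_pow (k : Type) [Field k] [CharP k 2] (f : MvPolynomial (Fin 5) k)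
    (hf : f = X 4 ^ 2 + X 0 ^ 4 * X 4 + X 1 ^ 3 + X 2 ^ 3 + X 3 ^ 3) :
    IsBlowup (affineBlowup.π (Ideal.span ((fun e : Fin 5 →₀ ℕ => Ideal.Quotient.mk (Ideal.span {f}) (monomial e (1 : k))) ''
        ((([![8, 0, 0, 0, 0], ![9, 0, 0, 0, 0], ![6, 1, 0, 0, 0], ![6, 0, 1, 0, 0], ![6, 0, 0, 1, 0], ![6, 0, 0, 0, 1]] : List (Fin 5 → ℕ)).map
          fun u => (Finsupp.equivFunOnFinite.symm u : Fin 5 →₀ ℕ)).toFinset : Set _))))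
      (affineBlowup.idealSheaf (Ideal.span {Ideal.Quotient.mk (Ideal.span {f}) (X 0) ^ 2, Ideal.Quotient.mk (Ideal.span {f}) (X 1),
          Ideal.Quotient.mk (Ideal.span {f}) (X 2), Ideal.Quotient.mk (Ideal.span {f}) (X 3), Ideal.Quotient.mk (Ideal.span {f}) (X 4)} ^ 4)) :=
  Summit.ResolutionOfSingularities.ResolutionOfSingularities.Theorems.CoreRungClosure.isBlowup_idealSheaf_pow
    (affineBlowup_IA_isBlowup_q k f hf) 4 (by norm_num)

end Summit.ResolutionOfSingularities.ResolutionOfSingularities.Theorems.FInjectiveMacaulayfication.FCentreE1ChartPresentation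

end
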